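import Mathlib.MeasureTheory.Integral.Prod
import Mathlib.MeasureTheory.Integral.IntervalIntegral.IntegrationByParts
import Mathlib.MeasureTheory.Integral.IntervalIntegral.FundThmCalculus
import Mathlib.MeasureTheory.Integral.DominatedConvergence
import Mathlib.MeasureTheory.Function.StronglyMeasurable.Basic
import Mathlib.MeasureTheory.Constructions.BorelSpace.Metrizable
import Mathlib.Analysis.Normed.Group.Tannery
import Literature.MathematicalPhysics.KineticTheory.InfiniteChainCorrelationContinuity
import Literature.MathematicalPhysics.KineticTheory.InfiniteChainGibbsInvariance
import Literature.MathematicalPhysics.KineticTheory.InfiniteChainGoodSetSymmetries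
import Literature.MathematicalPhysics.KineticTheory.FluctuationFoelnerPositivity
import HarnessLib

/-!
# Positive type of the current autocorrelation of the infinite chain

Topic `Literature/MathematicalPhysics/KineticTheory` (companion of `InfiniteChainDynamics`,
`InfiniteChainCurrentMoments`, `InfiniteChainCorrelationContinuity`, `InfiniteChainGoodSetSymmetries`,
`FluctuationFoelnerPositivity`). For an infinite-volume dynamics `D : InfiniteChainDynamics P` preserving
a state `μ` (`D.PreservesMeasure μ`), the Koopman operators `g ↦ g ∘ φ_t` are isometries of `L²(μ)`
forming a group on the (co-null) carrier, so every autocorrelation `F_g(t) = ∫ g · (g ∘ φ_t) dμ`,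
`g ∈ L²(μ)`, is an even function of positive type bounded by `F_g(0) = ‖g‖₂²`. We prove the
measure-theoretic form of this that the Green–Kubo objects of `InfiniteChainDynamics` consume:

* §1 the calculus identity `∫_{(0,t]²} F(u - s) du ds = 2 ∫_{(0,t]} (t - r) F(r) dr` for continuous
  even `F` (substitution, reflection, integration by parts), and change of variables along a
  measure-preserving (not necessarily injective) self-map for measurable integrands;
* §2 Koopman lemmas for `g ∈ L²(μ)`: integrability of `(g ∘ φ_s)(g ∘ φ_u)`, the isometry
  `∫ (g ∘ φ_u)² = ∫ g²`, the bound `|F_g(t)| ≤ ‖g‖₂²`, stationarity `∫ (g∘φ_s)(g∘φ_u) = F_g(u-s)`,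
  evenness, and **positivity of the doubly integrated form** `0 ≤ ∫_{(0,t]} (t-u) F_g(u) du`
  (`= ½ ∫ (∫_{(0,t]} g(φ_u σ) du)² dμ(σ)` by Fubini, for `g` continuous along the orbits of the carrier
  and `F_g` continuous; joint measurability of `(u, σ) ↦ g(φ_u σ)` on a measurable full-measure part
  of the carrier by `measurable_uncurry_of_continuous_of_measurable`) — the Tauberian condition of
  Hardy–Littlewood–Karamata at index `2` for `F_g`, obtained WITHOUT Bochner's theorem or Stone's
  theorem (no strong continuity of the Koopman group is used);
* §3 block currents `J_n = Σ_{i<n} j_i` of the chain (`j_x = bondCurrentZ`): shift covariance of the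
  pair correlations `∫ j_i (j_k ∘ φ_t) dμ = ∫ j_0 (j_{k-i} ∘ φ_t) dμ` for a shift-invariant `μ` and a
  flow commuting with the translations a.e.; `∫ J_n (J_n ∘ φ_t) = Σ_{i,k} ∫ j_i (j_k ∘ φ_t)`, its
  continuity in `t` under BM's superstability estimate (2.3); and the **Fejér representation**
  `n⁻¹ ∫ J_n (J_n ∘ φ_t) dμ → C(t) = D.currentCorrelation μ t` whenever the correlation sum converges
  absolutely at `t` (`D.HasAbsConvergentCorrelation μ t`; Tannery's theorem, counting lemmas of
  `FluctuationFoelnerPositivity`);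
* §4 consequences for `C = D.currentCorrelation μ` under (2.3), shift invariance, a.e. shift
  covariance and absolute convergence at every time: `C` is measurable (pointwise limit of continuous
  functions), `|C(t)| ≤ C(0)`, and `0 ≤ ∫_{(0,t]} (t - u) C(u) du` for `t ≥ 0`
  (`currentCorrelation_positiveType`); a.e. shift covariance holds for every dynamics with carrier
  inside BM's good set `𝒳₀` preserving a shift-invariant state (its flow is the Buttà–Marchioro flow
  on the carrier, `OscillatorChain.exists_bmDynamics`, which commutes with the translations on the
  shift-invariant `𝒳₀`), whence the BM-class corollary `currentCorrelation_positiveType_of_carrier_subset_bmGood`.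

Sources: positive-definiteness of stationary autocorrelations and the Fejér/Følner average are
standard (Khinchin; Doyon 2022 Lemma 4.5 and Thm 4.11 for the `ℋ₀` formulation, which needs space-time
clustering of a whole algebra of local observables and is NOT used here). Everything is proved;
tagged `[folklore]`. No definitions, no named facts. What is NOT here: strong continuity of the
Koopman group / continuity of `C` (only its measurability), and any decay of `C`.
-/

noncomputable section

open MeasureTheory Filter Set Function
open scoped Topology ENNReal BigOperators

namespace Literature.MathematicalPhysics.KineticTheory.HeatConduction

/-! ## §1 A calculus identity: `∫₀ᵗ∫₀ᵗ F(u-s) du ds = 2∫₀ᵗ (t-r) F(r) dr` for even continuous `F` -/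

/-- For a continuous even function `F` and `t ≥ 0`:
`∫_{(0,t]} ∫_{(0,t]} F(u - s) du ds = 2 ∫_{(0,t]} (t - r) F(r) dr`
(inner substitution `r = u - s` and evenness give `Φ(s) + Φ(t-s)` with `Φ(a) = ∫₀ᵃ F`; reflection
`s ↦ t - s`; integration by parts `∫₀ᵗ Φ = ∫₀ᵗ (t-r)F(r) dr`). [folklore] -/
theorem integral_Ioc_integral_Ioc_sub_eq {F : ℝ → ℝ} (hF : Continuous F)
    (heven : ∀ r, F (-r) = F r) {t : ℝ} (ht : 0 ≤ t) :
    ∫ s in Ioc 0 t, ∫ u in Ioc 0 t, F (u - s) = 2 * ∫ r in Ioc 0 t, (t - r) * F r := by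
  set Φ : ℝ → ℝ := fun a => ∫ r in (0:ℝ)..a, F r with hΦdef
  have hΦd : ∀ a, HasDerivAt Φ (F a) a := fun a => (hF.integral_hasStrictDerivAt 0 a).hasDerivAt
  have hΦc : Continuous Φ := continuous_iff_continuousAt.2 fun a => (hΦd a).continuousAt
  have hΦ0 : Φ 0 = 0 := intervalIntegral.integral_same
  have hint : ∀ a b : ℝ, IntervalIntegrable F volume a b := fun a b => hF.intervalIntegrable a b
  -- the inner integral
  have hinner : ∀ s, ∫ u in Ioc 0 t, F (u - s) = Φ s + Φ (t - s) := by
    intro s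
    rw [← intervalIntegral.integral_of_le ht, intervalIntegral.integral_comp_sub_right F s,
      zero_sub, ← intervalIntegral.integral_add_adjacent_intervals (hint (-s) 0) (hint 0 (t - s))]
    congr 1
    calc ∫ r in (-s)..0, F r = ∫ r in (-s)..0, F (-r) := by simp only [heven]
      _ = Φ s := by rw [intervalIntegral.integral_comp_neg]; simp [hΦdef]
  -- integration by parts
  have hparts : ∫ s in (0:ℝ)..t, Φ s = ∫ r in (0:ℝ)..t, (t - r) * F r := by
    have h := intervalIntegral.integral_mul_deriv_eq_deriv_mul (a := 0) (b := t)
      (u := fun x => x - t) (u' := fun _ => (1:ℝ)) (v := Φ) (v' := F)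
      (fun x _ => (hasDerivAt_id' x).sub_const t) (fun x _ => hΦd x)
      intervalIntegrable_const (hint 0 t)
    simp only [sub_self, zero_mul, mul_zero, one_mul, zero_sub, hΦ0] at h
    calc ∫ s in (0:ℝ)..t, Φ s = -∫ x in (0:ℝ)..t, (x - t) * F x := by linarith
      _ = ∫ r in (0:ℝ)..t, (t - r) * F r := by
        rw [← intervalIntegral.integral_neg]
        congr 1
        funext r
        ring
  calc ∫ s in Ioc 0 t, ∫ u in Ioc 0 t, F (u - s)
      = ∫ s in Ioc 0 t, (Φ s + Φ (t - s)) := by simp only [hinner]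
    _ = ∫ s in (0:ℝ)..t, (Φ s + Φ (t - s)) := (intervalIntegral.integral_of_le ht).symm
    _ = (∫ s in (0:ℝ)..t, Φ s) + ∫ s in (0:ℝ)..t, Φ (t - s) :=
        intervalIntegral.integral_add (hΦc.intervalIntegrable 0 t)
          ((hΦc.comp (continuous_const.sub continuous_id)).intervalIntegrable 0 t)
    _ = 2 * ∫ s in (0:ℝ)..t, Φ s := by
        rw [intervalIntegral.integral_comp_sub_left Φ t]
        simp only [sub_self, sub_zero]
        ring
    _ = 2 * ∫ r in Ioc 0 t, (t - r) * F r := by rw [hparts, intervalIntegral.integral_of_le ht]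

/-- Change of variables along a measure-preserving self-map, for a MEASURABLE integrand (no
injectivity of the map is needed). [folklore] -/
theorem integral_comp_eq_of_measurePreserving {α : Type*} [MeasurableSpace α] {ν : Measure α}
    {f : α → α} (hf : MeasurePreserving f ν ν) {g : α → ℝ} (hg : Measurable g) :
    ∫ x, g (f x) ∂ν = ∫ x, g x ∂ν := by
  have h := integral_map hf.measurable.aemeasurable (hg.aestronglyMeasurable (μ := ν.map f))
  rw [hf.map_eq] at h
  exact h.symm


/-! ## §2 Koopman lemmas: `g ∈ L²(μ)` along a `μ`-preserving dynamics -/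

namespace InfiniteChainDynamics

variable {P : OscillatorChain} (D : InfiniteChainDynamics P) {μ : Measure ChainConfig}

/-- `(g ∘ φ_s) · (g ∘ φ_u) ∈ L¹(μ)` for `g ∈ L²(μ)`. [folklore] -/
theorem integrable_comp_flow_mul_comp_flow (hD : D.PreservesMeasure μ) {g : ChainConfig → ℝ}
    (hg2 : MemLp g 2 μ) (s u : ℝ) :
    Integrable (fun σ => g (D.flow s σ) * g (D.flow u σ)) μ :=
  (hg2.comp_measurePreserving (hD.2 s)).integrable_mul (hg2.comp_measurePreserving (hD.2 u))

/-- Koopman isometry on squares: `∫ (g ∘ φ_u)² dμ = ∫ g² dμ`. [folklore] -/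
theorem integral_sq_comp_flow (hD : D.PreservesMeasure μ) {g : ChainConfig → ℝ}
    (hg : Measurable g) (u : ℝ) : ∫ σ, g (D.flow u σ) ^ 2 ∂μ = ∫ σ, g σ ^ 2 ∂μ :=
  integral_comp_eq_of_measurePreserving (hD.2 u) (hg.pow_const 2)

/-- `∫ |g ∘ φ_s| |g ∘ φ_u| dμ ≤ ∫ g² dμ` (`2|ab| ≤ a² + b²` and the isometry). [folklore] -/
theorem integral_abs_comp_flow_mul_comp_flow_le (hD : D.PreservesMeasure μ)
    {g : ChainConfig → ℝ} (hg : Measurable g) (hg2 : MemLp g 2 μ) (s u : ℝ) :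
    ∫ σ, |g (D.flow s σ) * g (D.flow u σ)| ∂μ ≤ ∫ σ, g σ ^ 2 ∂μ := by
  have hs : Integrable (fun σ => g (D.flow s σ) ^ 2) μ :=
    (hg2.comp_measurePreserving (hD.2 s)).integrable_sq
  have hu : Integrable (fun σ => g (D.flow u σ) ^ 2) μ :=
    (hg2.comp_measurePreserving (hD.2 u)).integrable_sq
  calc ∫ σ, |g (D.flow s σ) * g (D.flow u σ)| ∂μ
      ≤ ∫ σ, (g (D.flow s σ) ^ 2 + g (D.flow u σ) ^ 2) / 2 ∂μ := by
        refine integral_mono (D.integrable_comp_flow_mul_comp_flow hD hg2 s u).abs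
          ((hs.add hu).div_const 2) fun σ => ?_
        have h := two_mul_le_add_sq |g (D.flow s σ)| |g (D.flow u σ)|
        rw [sq_abs, sq_abs] at h
        dsimp only
        rw [abs_mul]
        linarith
    _ = ∫ σ, g σ ^ 2 ∂μ := by
        rw [integral_div, integral_add hs hu, D.integral_sq_comp_flow hD hg s,
          D.integral_sq_comp_flow hD hg u]
        ring

/-- **Stationarity**: `∫ (g ∘ φ_s)(g ∘ φ_u) dμ = ∫ g · (g ∘ φ_{u-s}) dμ` (group law on the carrier,
which has full measure, and invariance of `μ` under `φ_s`). [folklore] -/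
theorem integral_comp_flow_mul_comp_flow_eq (hD : D.PreservesMeasure μ) {g : ChainConfig → ℝ}
    (hg : Measurable g) (s u : ℝ) :
    ∫ σ, g (D.flow s σ) * g (D.flow u σ) ∂μ = ∫ σ, g σ * g (D.flow (u - s) σ) ∂μ := by
  have hae : (fun σ => g (D.flow s σ) * g (D.flow u σ)) =ᵐ[μ]
      fun σ => (fun τ => g τ * g (D.flow (u - s) τ)) (D.flow s σ) := by
    filter_upwards [hD.1] with σ hσ
    show g (D.flow s σ) * g (D.flow u σ) = g (D.flow s σ) * g (D.flow (u - s) (D.flow s σ))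
    rw [← D.flow_add hσ, sub_add_cancel]
  rw [integral_congr_ae hae]
  exact integral_comp_eq_of_measurePreserving (hD.2 s)
    (hg.mul (hg.comp (hD.2 (u - s)).measurable))

/-- **Evenness** of the autocorrelation `t ↦ ∫ g · (g ∘ φ_t) dμ`. [folklore] -/
theorem integral_mul_comp_flow_neg (hD : D.PreservesMeasure μ) {g : ChainConfig → ℝ}
    (hg : Measurable g) (r : ℝ) :
    ∫ σ, g σ * g (D.flow (-r) σ) ∂μ = ∫ σ, g σ * g (D.flow r σ) ∂μ := by
  have h1 := D.integral_comp_flow_mul_comp_flow_eq hD hg r 0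
  have h2 := D.integral_comp_flow_mul_comp_flow_eq hD hg 0 r
  rw [zero_sub] at h1
  rw [sub_zero] at h2
  rw [← h1, ← h2]
  exact integral_congr_ae (Eventually.of_forall fun σ => mul_comm _ _)

/-- At `t = 0` the autocorrelation is `‖g‖₂²`. [folklore] -/
theorem integral_mul_comp_flow_zero (hD : D.PreservesMeasure μ) (g : ChainConfig → ℝ) :
    ∫ σ, g σ * g (D.flow 0 σ) ∂μ = ∫ σ, g σ ^ 2 ∂μ := by
  refine integral_congr_ae ?_
  filter_upwards [hD.1] with σ hσ
  rw [D.flow_zero σ hσ, sq]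

/-- **Boundedness** `|∫ g · (g ∘ φ_t) dμ| ≤ ‖g‖₂²`. [folklore] -/
theorem abs_integral_mul_comp_flow_le (hD : D.PreservesMeasure μ) {g : ChainConfig → ℝ}
    (hg : Measurable g) (hg2 : MemLp g 2 μ) (t : ℝ) :
    |∫ σ, g σ * g (D.flow t σ) ∂μ| ≤ ∫ σ, g σ ^ 2 ∂μ := by
  have h := D.integral_comp_flow_mul_comp_flow_eq hD hg 0 t
  rw [sub_zero] at h
  rw [← h]
  exact abs_integral_le_integral_abs.trans
    (D.integral_abs_comp_flow_mul_comp_flow_le hD hg hg2 0 t)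

/-- **Positive type, doubly integrated form.** For `g ∈ L²(μ)` measurable, continuous along the
orbits of the carrier, with continuous autocorrelation `F(t) = ∫ g · (g ∘ φ_t) dμ`:
`0 ≤ ∫_{(0,t]} (t - u) F(u) du` for `t ≥ 0`, because this equals `½ ∫ (∫_{(0,t]} g(φ_u σ) du)² dμ(σ)`
(Fubini for the jointly measurable `(u, σ) ↦ g(φ_u σ)` on a measurable full-measure part of the
carrier, stationarity `∫ g(φ_s σ) g(φ_u σ) dμ = F(u - s)`, and `integral_Ioc_integral_Ioc_sub_eq`).
[folklore] -/
theorem integral_Ioc_sub_mul_nonneg [IsFiniteMeasure μ] (hD : D.PreservesMeasure μ)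
    {g : ChainConfig → ℝ} (hg : Measurable g) (hg2 : MemLp g 2 μ)
    (hcont : ∀ σ ∈ D.carrier, Continuous fun t => g (D.flow t σ))
    (hF : Continuous fun t => ∫ σ, g σ * g (D.flow t σ) ∂μ) {t : ℝ} (ht : 0 ≤ t) :
    0 ≤ ∫ u in Ioc 0 t, (t - u) * ∫ σ, g σ * g (D.flow u σ) ∂μ := by
  -- a measurable full-measure subset of the carrier
  obtain ⟨Z, hZsub, hZm, hZ0⟩ := exists_measurable_superset_of_null (ae_iff.1 hD.1)
  set S : Set ChainConfig := Zᶜ with hSdef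
  have hSm : MeasurableSet S := hZm.compl
  have hSsub : S ⊆ D.carrier := fun σ hσ => by_contra fun h => hσ (hZsub h)
  have hSae : ∀ᵐ σ ∂μ, σ ∈ S := by
    rw [ae_iff]
    have : {a | ¬a ∈ S} = Z := by ext a; simp [hSdef]
    rw [this]
    exact hZ0
  -- the jointly measurable modification of `(u, σ) ↦ g (φ_u σ)`
  set K : ℝ → ChainConfig → ℝ := fun u σ => S.indicator (fun σ => g (D.flow u σ)) σ with hKdef
  have hKm : ∀ u, Measurable (K u) := fun u => (hg.comp (hD.2 u).measurable).indicator hSm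
  have hKc : ∀ σ, Continuous fun u => K u σ := by
    intro σ
    by_cases hσ : σ ∈ S
    · simp only [hKdef, indicator_of_mem hσ]
      exact hcont σ (hSsub hσ)
    · simp only [hKdef, indicator_of_notMem hσ]
      exact continuous_const
  have hKjm : Measurable (Function.uncurry K) :=
    measurable_uncurry_of_continuous_of_measurable hKc hKm
  have hKae : ∀ u, K u =ᵐ[μ] fun σ => g (D.flow u σ) := fun u => by
    filter_upwards [hSae] with σ hσ
    simp only [hKdef, indicator_of_mem hσ]
  have hK2 : ∀ u, MemLp (K u) 2 μ := fun u =>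
    (hg2.comp_measurePreserving (hD.2 u)).ae_eq (hKae u).symm
  set F : ℝ → ℝ := fun t => ∫ σ, g σ * g (D.flow t σ) ∂μ with hFdef
  set A : ℝ := ∫ σ, g σ ^ 2 ∂μ with hAdef
  have hKK : ∀ s u, ∫ σ, K s σ * K u σ ∂μ = F (u - s) := by
    intro s u
    show ∫ σ, K s σ * K u σ ∂μ = ∫ σ, g σ * g (D.flow (u - s) σ) ∂μ
    rw [← D.integral_comp_flow_mul_comp_flow_eq hD hg s u]
    refine integral_congr_ae ?_
    filter_upwards [hSae] with σ hσ
    simp only [hKdef, indicator_of_mem hσ]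
  have hKKabs : ∀ s u, ∫ σ, |K s σ * K u σ| ∂μ ≤ A := by
    intro s u
    have hae : (fun σ => |K s σ * K u σ|) =ᵐ[μ] fun σ => |g (D.flow s σ) * g (D.flow u σ)| := by
      filter_upwards [hSae] with σ hσ
      simp only [hKdef, indicator_of_mem hσ]
    rw [integral_congr_ae hae]
    exact D.integral_abs_comp_flow_mul_comp_flow_le hD hg hg2 s u
  have hFabs : ∀ r, |F r| ≤ A := fun r => D.abs_integral_mul_comp_flow_le hD hg hg2 r
  -- the product measure on the time square
  set ρ : Measure ℝ := volume.restrict (Ioc (0:ℝ) t) with hρdef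
  set π : Measure (ℝ × ℝ) := ρ.prod ρ with hπdef
  have hHm : Measurable fun x : (ℝ × ℝ) × ChainConfig => K x.1.1 x.2 * K x.1.2 x.2 := by
    have h1 : Measurable fun x : (ℝ × ℝ) × ChainConfig => K x.1.1 x.2 :=
      hKjm.comp (measurable_fst.fst.prodMk measurable_snd)
    have h2 : Measurable fun x : (ℝ × ℝ) × ChainConfig => K x.1.2 x.2 :=
      hKjm.comp (measurable_fst.snd.prodMk measurable_snd)
    exact h1.mul h2
  have hHint : Integrable (fun x : (ℝ × ℝ) × ChainConfig => K x.1.1 x.2 * K x.1.2 x.2)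
      (π.prod μ) := by
    refine (integrable_prod_iff hHm.aestronglyMeasurable).2 ⟨Eventually.of_forall fun p => ?_, ?_⟩
    · exact (hK2 p.1).integrable_mul (hK2 p.2)
    · refine Integrable.mono' (integrable_const A) hHm.aestronglyMeasurable.norm.integral_prod_right'
        (Eventually.of_forall fun p => ?_)
      show ‖∫ σ, ‖K p.1 σ * K p.2 σ‖ ∂μ‖ ≤ A
      rw [Real.norm_eq_abs, abs_of_nonneg (integral_nonneg fun σ => norm_nonneg _)]
      simp only [Real.norm_eq_abs]
      exact hKKabs p.1 p.2
  have hFint : Integrable (fun p : ℝ × ℝ => F (p.2 - p.1)) π := by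
    refine Integrable.mono' (integrable_const A)
      (hF.comp (continuous_snd.sub continuous_fst)).aestronglyMeasurable
      (Eventually.of_forall fun p => ?_)
    rw [Real.norm_eq_abs]
    exact hFabs _
  -- the computation
  have hsq : ∀ σ, (∫ u, K u σ ∂ρ) ^ 2 = ∫ p, K p.1 σ * K p.2 σ ∂π := fun σ => by
    rw [sq, hπdef, ← integral_prod_mul (μ := ρ) (ν := ρ) (fun u => K u σ) (fun u => K u σ)]
  have hHint' : Integrable (Function.uncurry fun (σ : ChainConfig) (p : ℝ × ℝ) => K p.1 σ * K p.2 σ)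
      (μ.prod π) := hHint.swap
  have hswap : ∫ σ, ∫ p, K p.1 σ * K p.2 σ ∂π ∂μ = ∫ p, ∫ σ, K p.1 σ * K p.2 σ ∂μ ∂π :=
    integral_integral_swap hHint'
  have hmain : ∫ σ, (∫ u, K u σ ∂ρ) ^ 2 ∂μ = 2 * ∫ u in Ioc 0 t, (t - u) * F u := by
    calc ∫ σ, (∫ u, K u σ ∂ρ) ^ 2 ∂μ = ∫ σ, ∫ p, K p.1 σ * K p.2 σ ∂π ∂μ := by simp only [hsq]
      _ = ∫ p, ∫ σ, K p.1 σ * K p.2 σ ∂μ ∂π := hswap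
      _ = ∫ p, F (p.2 - p.1) ∂π := by simp only [hKK]
      _ = ∫ s, ∫ u, F (u - s) ∂ρ ∂ρ := integral_prod (fun p : ℝ × ℝ => F (p.2 - p.1)) hFint
      _ = 2 * ∫ u in Ioc 0 t, (t - u) * F u :=
          integral_Ioc_integral_Ioc_sub_eq hF (D.integral_mul_comp_flow_neg hD hg) ht
  have h0 : 0 ≤ ∫ σ, (∫ u, K u σ ∂ρ) ^ 2 ∂μ := integral_nonneg fun σ => sq_nonneg _
  rw [hmain] at h0
  have h2 : 0 ≤ ∫ u in Ioc 0 t, (t - u) * F u := by linarith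
  simpa only [hFdef] using h2


/-! ## §3 Block currents of the chain: shift covariance and Fejér averaging -/

variable {s₂ : ℕ}

/-- **Shift covariance of the pair correlations**: if `μ` is shift-invariant and the flow commutes
with the lattice translations `μ`-a.e., then `∫ j_i (j_k ∘ φ_t) dμ = ∫ j_0 (j_{k-i} ∘ φ_t) dμ`. [folklore] -/
theorem integral_bondCurrentZ_mul_flow_eq_of_shift (hD : D.PreservesMeasure μ)
    (hμ : IsShiftInvariant μ)
    (hcomm : ∀ (t : ℝ) (x : ℤ), D.flow t ∘ chainShift x =ᵐ[μ] chainShift x ∘ D.flow t)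
    (t : ℝ) (i k : ℤ) :
    ∫ σ, P.bondCurrentZ σ i * P.bondCurrentZ (D.flow t σ) k ∂μ =
      ∫ σ, P.bondCurrentZ σ 0 * P.bondCurrentZ (D.flow t σ) (k - i) ∂μ := by
  have hae : (fun σ => P.bondCurrentZ σ i * P.bondCurrentZ (D.flow t σ) k) =ᵐ[μ]
      fun σ => (fun τ => P.bondCurrentZ τ 0 * P.bondCurrentZ (D.flow t τ) (k - i))
        (chainShift i σ) := by
    filter_upwards [hcomm t i] with σ hσ
    rw [comp_apply, comp_apply] at hσ
    show _ = P.bondCurrentZ (chainShift i σ) 0 * P.bondCurrentZ (D.flow t (chainShift i σ)) (k - i)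
    rw [hσ, P.bondCurrentZ_chainShift, P.bondCurrentZ_chainShift, zero_add, sub_add_cancel]
  rw [integral_congr_ae hae]
  exact integral_comp_eq_of_measurePreserving (hμ.measurePreserving_chainShift i)
    ((measurable_bondCurrentZ P 0).mul ((measurable_bondCurrentZ P (k - i)).comp (hD.2 t).measurable))

/-- The block-current correlation is the sum of the pair correlations:
`∫ J_n (J_n ∘ φ_t) dμ = Σ_{i,k<n} ∫ j_i (j_k ∘ φ_t) dμ`, `J_n = Σ_{i<n} j_i` (`j_x ∈ L²(μ)`). [folklore] -/
theorem integral_block_mul_block_flow (hD : D.PreservesMeasure μ)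
    (hj2 : ∀ x : ℤ, MemLp (fun σ => P.bondCurrentZ σ x) 2 μ) (n : ℕ) (t : ℝ) :
    ∫ σ, (∑ i ∈ Finset.range n, P.bondCurrentZ σ i) *
        (∑ k ∈ Finset.range n, P.bondCurrentZ (D.flow t σ) k) ∂μ =
      ∑ i ∈ Finset.range n, ∑ k ∈ Finset.range n,
        ∫ σ, P.bondCurrentZ σ i * P.bondCurrentZ (D.flow t σ) k ∂μ := by
  have hint : ∀ i k : ℕ, Integrable
      (fun σ => P.bondCurrentZ σ i * P.bondCurrentZ (D.flow t σ) k) μ := fun i k =>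
    (hj2 i).integrable_mul ((hj2 k).comp_measurePreserving (hD.2 t))
  simp_rw [Finset.sum_mul_sum]
  rw [integral_finsetSum _ fun i _ => integrable_finsetSum _ fun k _ => hint i k]
  refine Finset.sum_congr rfl fun i _ => ?_
  rw [integral_finsetSum _ fun k _ => hint i k]

/-- **Continuity in time of the block-current correlation** under BM's superstability estimate
(finite sum of the continuous pair correlations of `InfiniteChainCorrelationContinuity`). [folklore] -/
theorem continuous_integral_block_mul_block_flow (hss : P.HasSuperstabilityEstimate μ)
    (h₂ : 1 ≤ s₂) (hU0 : ∀ r, 0 ≤ P.U r) (hUm : Measurable P.U)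
    (hV : OscillatorChain.IsEvenPolyOfDegree P.V s₂) (hD : D.PreservesMeasure μ) (n : ℕ) :
    Continuous fun t : ℝ => ∫ σ, (∑ i ∈ Finset.range n, P.bondCurrentZ σ i) *
        (∑ k ∈ Finset.range n, P.bondCurrentZ (D.flow t σ) k) ∂μ := by
  have hj2 : ∀ x : ℤ, MemLp (fun σ => P.bondCurrentZ σ x) 2 μ := fun x =>
    hss.memLp_bondCurrentZ h₂ hU0 hUm hV x ENNReal.ofNat_ne_top
  simp only [D.integral_block_mul_block_flow hD hj2 n]
  exact continuous_finsetSum _ fun i _ => continuous_finsetSum _ fun k _ =>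
    D.continuous_integral_bondCurrentZ_mul_flow hss h₂ hU0 hUm hV hD k i

/-- **Fejér averaging.** Under shift covariance, `n⁻¹ ∫ J_n (J_n ∘ φ_t) dμ → C(t) = Σ_x ∫ j_0 (j_x ∘ φ_t) dμ`
as `n → ∞`, whenever the correlation sum converges absolutely at `t`
(`n⁻¹ ∫ J_n (J_n ∘ φ_t) = Σ_d (N_n(d)/n) c_d(t)` with `n - |d| ≤ N_n(d) ≤ n`, and Tannery's theorem). [folklore] -/
theorem tendsto_inv_mul_integral_block_mul_block_flow (hD : D.PreservesMeasure μ)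
    (hμ : IsShiftInvariant μ)
    (hcomm : ∀ (t : ℝ) (x : ℤ), D.flow t ∘ chainShift x =ᵐ[μ] chainShift x ∘ D.flow t)
    (hj2 : ∀ x : ℤ, MemLp (fun σ => P.bondCurrentZ σ x) 2 μ) {t : ℝ}
    (hAC : D.HasAbsConvergentCorrelation μ t) :
    Tendsto (fun n : ℕ => (n : ℝ)⁻¹ * ∫ σ, (∑ i ∈ Finset.range n, P.bondCurrentZ σ i) *
        (∑ k ∈ Finset.range n, P.bondCurrentZ (D.flow t σ) k) ∂μ) atTop
      (𝓝 (D.currentCorrelation μ t)) := by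
  classical
  set c : ℤ → ℝ := fun d => ∫ σ, P.bondCurrentZ σ 0 * P.bondCurrentZ (D.flow t σ) d ∂μ with hc
  obtain ⟨N, hN⟩ : ∃ N : ℕ → ℤ → ℕ, ∀ (n : ℕ) (d : ℤ),
      ((Finset.range n ×ˢ Finset.range n).filter
        (fun p : ℕ × ℕ => (p.2 : ℤ) - p.1 = d)).card = N n d := ⟨_, fun _ _ => rfl⟩
  have hN_le : ∀ (n : ℕ) (d : ℤ), (N n d : ℝ) ≤ n := fun n d => by
    rw [← hN]; exact_mod_cast card_filter_sub_eq_le n d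
  have hN_ge : ∀ (n : ℕ) (d : ℤ), (n : ℝ) - |(d : ℝ)| ≤ N n d := fun n d => by
    rw [← hN]; exact sub_abs_le_card_filter_sub_eq n d
  -- Step 1: the block correlation is `Σ_{(i,k)} c (k - i)`
  have hblock : ∀ n : ℕ, ∫ σ, (∑ i ∈ Finset.range n, P.bondCurrentZ σ i) *
      (∑ k ∈ Finset.range n, P.bondCurrentZ (D.flow t σ) k) ∂μ =
        ∑ p ∈ Finset.range n ×ˢ Finset.range n, c ((p.2 : ℤ) - p.1) := by
    intro n
    rw [D.integral_block_mul_block_flow hD hj2 n, Finset.sum_product]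
    refine Finset.sum_congr rfl fun i _ => Finset.sum_congr rfl fun k _ => ?_
    exact D.integral_bondCurrentZ_mul_flow_eq_of_shift hD hμ hcomm t i k
  -- Step 2: regroup along the fibres `k - i = d`
  have hfib : ∀ n : ℕ, ∑ p ∈ Finset.range n ×ˢ Finset.range n, c ((p.2 : ℤ) - p.1) =
      ∑' d : ℤ, (N n d : ℝ) * c d := by
    intro n
    set s := Finset.range n ×ˢ Finset.range n with hs
    set u : Finset ℤ := Finset.Ioo (-(n : ℤ)) n with hu
    have hmaps : ∀ p ∈ s, ((p.2 : ℤ) - p.1) ∈ u := by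
      intro p hp
      obtain ⟨h1, h2⟩ := Finset.mem_product.1 hp
      have h1' := Finset.mem_range.1 h1
      have h2' := Finset.mem_range.1 h2
      simp only [hu, Finset.mem_Ioo]
      omega
    rw [← Finset.sum_fiberwise_of_maps_to hmaps]
    have hinner : ∀ d ∈ u, ∑ p ∈ s with ((p.2 : ℤ) - p.1 = d), c ((p.2 : ℤ) - p.1) =
        (N n d : ℝ) * c d := by
      intro d _
      rw [Finset.sum_congr rfl (fun p hp => by rw [(Finset.mem_filter.1 hp).2]), Finset.sum_const,
        nsmul_eq_mul, hN]
    rw [Finset.sum_congr rfl hinner]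
    refine (tsum_eq_sum fun d hd => ?_).symm
    have h0 : N n d = 0 := by
      rw [← hN]
      refine Finset.card_eq_zero.2 (Finset.filter_eq_empty_iff.2 fun p hp h => hd ?_)
      exact h ▸ hmaps p hp
    rw [h0, Nat.cast_zero, zero_mul]
  -- Step 3: Tannery
  have he : ∀ n : ℕ, (n : ℝ)⁻¹ * ∫ σ, (∑ i ∈ Finset.range n, P.bondCurrentZ σ i) *
      (∑ k ∈ Finset.range n, P.bondCurrentZ (D.flow t σ) k) ∂μ =
        ∑' d : ℤ, ((N n d : ℝ) / n) * c d := by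
    intro n
    rw [hblock, hfib, ← tsum_mul_left]
    refine tsum_congr fun d => ?_
    ring
  simp only [he]
  have hlim : Tendsto (fun n : ℕ => ∑' d : ℤ, ((N n d : ℝ) / n) * c d) atTop (𝓝 (∑' d : ℤ, c d)) := by
    refine tendsto_tsum_of_dominated_convergence (bound := fun d => |c d|) hAC.2 (fun d => ?_) ?_
    · have hw : Tendsto (fun n : ℕ => (N n d : ℝ) / n) atTop (𝓝 1) := by
        have hlow : Tendsto (fun n : ℕ => 1 - |(d : ℝ)| / n) atTop (𝓝 1) := by
          have h := (tendsto_const_div_atTop_nhds_zero_nat |(d : ℝ)|)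
          simpa using (tendsto_const_nhds (x := (1 : ℝ))).sub h
        refine tendsto_of_tendsto_of_tendsto_of_le_of_le' hlow tendsto_const_nhds ?_ ?_
        · filter_upwards [eventually_gt_atTop 0] with n hn
          have hn' : (0 : ℝ) < n := by exact_mod_cast hn
          rw [sub_le_iff_le_add, ← add_div, le_div_iff₀ hn', one_mul]
          linarith [hN_ge n d]
        · filter_upwards [eventually_gt_atTop 0] with n hn
          have hn' : (0 : ℝ) < n := by exact_mod_cast hn
          rw [div_le_one hn']
          exact hN_le n d
      simpa using hw.mul_const (c d)
    · filter_upwards [eventually_gt_atTop 0] with n hn d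
      have hn' : (0 : ℝ) < n := by exact_mod_cast hn
      rw [Real.norm_eq_abs, abs_mul, abs_div, Nat.abs_cast, Nat.abs_cast]
      refine mul_le_of_le_one_left (abs_nonneg _) ?_
      rw [div_le_one hn']
      exact hN_le n d
  exact hlim


/-! ## §4 Positive type of `currentCorrelation` -/

/-- `|∫ J_n (J_n ∘ φ_t) dμ| ≤ ∫ J_n (J_n ∘ φ_0) dμ = ‖J_n‖₂²` for the block currents (`j_x ∈ L²(μ)`). [folklore] -/
theorem abs_integral_block_mul_block_flow_le (hD : D.PreservesMeasure μ)
    (hj2 : ∀ x : ℤ, MemLp (fun σ => P.bondCurrentZ σ x) 2 μ) (n : ℕ) (t : ℝ) :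
    |∫ σ, (∑ i ∈ Finset.range n, P.bondCurrentZ σ i) *
        (∑ k ∈ Finset.range n, P.bondCurrentZ (D.flow t σ) k) ∂μ| ≤
      ∫ σ, (∑ i ∈ Finset.range n, P.bondCurrentZ σ i) *
        (∑ k ∈ Finset.range n, P.bondCurrentZ (D.flow 0 σ) k) ∂μ := by
  have hJm : Measurable fun σ : ChainConfig => ∑ i ∈ Finset.range n, P.bondCurrentZ σ i :=
    Finset.measurable_sum _ fun i _ => measurable_bondCurrentZ _ i
  have hJ2 : MemLp (fun σ : ChainConfig => ∑ i ∈ Finset.range n, P.bondCurrentZ σ i) 2 μ :=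
    memLp_finsetSum _ fun i _ => hj2 i
  rw [D.integral_mul_comp_flow_zero hD]
  exact D.abs_integral_mul_comp_flow_le hD hJm hJ2 t

/-- **Positive type of the current autocorrelation.** For a chain with `U ≥ 0` measurable and `V` an
even non-negative polynomial of degree `≥ 2`, a state `μ` with BM's superstability estimate (2.3) that
is shift-invariant and preserved by `D`, a flow commuting with the lattice translations `μ`-a.e., and
absolutely convergent correlation sums at every time: `C = D.currentCorrelation μ` is measurable,
`|C(t)| ≤ C(0)` for all `t`, and `0 ≤ ∫_{(0,t]} (t - u) C(u) du` for all `t ≥ 0`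
(`C(t) = lim_n n⁻¹ ∫ J_n (J_n ∘ φ_t) dμ` with each approximant continuous, bounded by its value at
`0`, and of positive type in the doubly integrated form; dominated convergence on `(0, t]`). [folklore] -/
theorem currentCorrelation_positiveType (hss : P.HasSuperstabilityEstimate μ) (h₂ : 1 ≤ s₂)
    (hU0 : ∀ r, 0 ≤ P.U r) (hUm : Measurable P.U) (hV : OscillatorChain.IsEvenPolyOfDegree P.V s₂)
    (hD : D.PreservesMeasure μ) (hμ : IsShiftInvariant μ)
    (hcomm : ∀ (t : ℝ) (x : ℤ), D.flow t ∘ chainShift x =ᵐ[μ] chainShift x ∘ D.flow t)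
    (hAC : ∀ t : ℝ, D.HasAbsConvergentCorrelation μ t) :
    Measurable (D.currentCorrelation μ) ∧
    (∀ t : ℝ, |D.currentCorrelation μ t| ≤ D.currentCorrelation μ 0) ∧
    ∀ t : ℝ, 0 ≤ t → 0 ≤ ∫ u in Ioc 0 t, (t - u) * D.currentCorrelation μ u := by
  haveI : IsProbabilityMeasure μ := hss.1
  have hVc : Continuous (deriv P.V) := hV.contDiff_two.continuous_deriv (by norm_num)
  have hj2 : ∀ x : ℤ, MemLp (fun σ => P.bondCurrentZ σ x) 2 μ := fun x =>
    hss.memLp_bondCurrentZ h₂ hU0 hUm hV x ENNReal.ofNat_ne_top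
  -- the block correlations `Φ n t = ∫ J_n (J_n ∘ φ_t) dμ`
  set Φ : ℕ → ℝ → ℝ := fun n t => ∫ σ, (∑ i ∈ Finset.range n, P.bondCurrentZ σ i) *
      (∑ k ∈ Finset.range n, P.bondCurrentZ (D.flow t σ) k) ∂μ with hΦdef
  have hlim : ∀ t : ℝ, Tendsto (fun n : ℕ => (n : ℝ)⁻¹ * Φ n t) atTop
      (𝓝 (D.currentCorrelation μ t)) := fun t =>
    D.tendsto_inv_mul_integral_block_mul_block_flow hD hμ hcomm hj2 (hAC t)
  have hΦc : ∀ n : ℕ, Continuous (Φ n) := fun n =>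
    D.continuous_integral_block_mul_block_flow hss h₂ hU0 hUm hV hD n
  have hJm : ∀ n : ℕ, Measurable fun σ : ChainConfig =>
      ∑ i ∈ Finset.range n, P.bondCurrentZ σ i := fun n =>
    Finset.measurable_sum _ fun i _ => measurable_bondCurrentZ _ i
  have hJ2 : ∀ n : ℕ, MemLp (fun σ : ChainConfig => ∑ i ∈ Finset.range n, P.bondCurrentZ σ i) 2 μ :=
    fun n => memLp_finsetSum _ fun i _ => hj2 i
  have hbound : ∀ (n : ℕ) (t : ℝ), |Φ n t| ≤ Φ n 0 := fun n t =>
    D.abs_integral_block_mul_block_flow_le hD hj2 n t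
  refine ⟨?_, fun t => ?_, fun t ht => ?_⟩
  · -- measurability: pointwise limit of continuous functions
    exact measurable_of_tendsto_metrizable (fun n => (continuous_const.mul (hΦc n)).measurable)
      (tendsto_pi_nhds.2 hlim)
  · -- boundedness by `C(0)`
    refine le_of_tendsto_of_tendsto' (hlim t).abs (hlim 0) fun n => ?_
    rw [abs_mul, abs_of_nonneg (inv_nonneg.2 (Nat.cast_nonneg n))]
    exact mul_le_mul_of_nonneg_left (hbound n t) (inv_nonneg.2 (Nat.cast_nonneg n))
  · -- positivity of the doubly integrated form
    have hVn : ∀ n : ℕ, 0 ≤ ∫ u in Ioc 0 t, (t - u) * ((n : ℝ)⁻¹ * Φ n u) := fun n => by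
      have h : 0 ≤ ∫ u in Ioc 0 t, (t - u) * Φ n u :=
        D.integral_Ioc_sub_mul_nonneg hD (hJm n) (hJ2 n)
          (fun σ hσ => continuous_finsetSum _ fun i _ => D.continuous_bondCurrentZ_flow hVc hσ i)
          (hΦc n) ht
      calc (0 : ℝ) ≤ (n : ℝ)⁻¹ * ∫ u in Ioc 0 t, (t - u) * Φ n u :=
            mul_nonneg (inv_nonneg.2 (Nat.cast_nonneg n)) h
        _ = ∫ u in Ioc 0 t, (t - u) * ((n : ℝ)⁻¹ * Φ n u) := by
            rw [← integral_const_mul]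
            refine integral_congr_ae (Eventually.of_forall fun u => ?_)
            ring
    obtain ⟨B, hB⟩ := (hlim 0).bddAbove_range
    have hdom : Tendsto (fun n : ℕ => ∫ u in Ioc 0 t, (t - u) * ((n : ℝ)⁻¹ * Φ n u)) atTop
        (𝓝 (∫ u in Ioc 0 t, (t - u) * D.currentCorrelation μ u)) := by
      refine tendsto_integral_of_dominated_convergence (fun _ => t * B)
        (fun n => ((continuous_const.sub continuous_id).mul
          (continuous_const.mul (hΦc n))).aestronglyMeasurable)
        (integrable_const _) (fun n => ?_) (Eventually.of_forall fun u => (hlim u).const_mul (t - u))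
      filter_upwards [ae_restrict_mem measurableSet_Ioc] with u hu
      rw [Real.norm_eq_abs, abs_mul]
      refine mul_le_mul ?_ ?_ (abs_nonneg _) ht
      · rw [abs_of_nonneg (by linarith [hu.2])]
        linarith [hu.1]
      · rw [abs_mul, abs_of_nonneg (inv_nonneg.2 (Nat.cast_nonneg n))]
        exact (mul_le_mul_of_nonneg_left (hbound n u) (inv_nonneg.2 (Nat.cast_nonneg n))).trans
          (hB ⟨n, rfl⟩)
    exact ge_of_tendsto' hdom hVn

/-- **A.e. shift covariance inside BM's good set.** For `U`, `V` even non-negative polynomials of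
degree `≥ 2`: if `D.carrier ⊆ 𝒳₀ = bmGood P` and `D` preserves a shift-invariant state `μ`, then
`φ_t ∘ τ_x = τ_x ∘ φ_t` `μ`-a.e. (on the carrier `D.flow` is the Buttà–Marchioro flow of
`OscillatorChain.exists_bmDynamics` by its uniqueness clause, and that flow commutes with the translations
on the shift-invariant set `𝒳₀`; `μ`-a.e. point lies in the carrier together with its translate). [folklore] -/
theorem flow_comp_chainShift_ae_of_carrier_subset_bmGood {s₁ : ℕ} (hs₁ : 1 ≤ s₁) (hs₂ : 1 ≤ s₂)
    (hU : OscillatorChain.IsEvenPolyOfDegree P.U s₁) (hV : OscillatorChain.IsEvenPolyOfDegree P.V s₂)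
    (hcar : D.carrier ⊆ P.bmGood) (hD : D.PreservesMeasure μ) (hμ : IsShiftInvariant μ)
    (t : ℝ) (x : ℤ) : D.flow t ∘ chainShift x =ᵐ[μ] chainShift x ∘ D.flow t := by
  have hU0 : ∀ r, 0 ≤ P.U r := hU.choose_spec.2.2
  have hV0 : ∀ r, 0 ≤ P.V r := hV.choose_spec.2.2
  obtain ⟨D₀, hD₀car, -⟩ := OscillatorChain.exists_bmDynamics hs₁ hs₂ hU hV
  have hflow_eq : ∀ σ ∈ D.carrier, ∀ t, D.flow t σ = D₀.flow t σ := fun σ hσ t => by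
    have h := D₀.unique (fun u => D.flow u σ)
      (fun u => by rw [hD₀car]; exact hcar (D.flow_mem hσ u)) (D.isSolution σ hσ) t
    simpa only [D.flow_zero σ hσ] using h
  have h2 : ∀ᵐ σ ∂μ, chainShift x σ ∈ D.carrier :=
    (hμ.measurePreserving_chainShift x).quasiMeasurePreserving.ae hD.1
  filter_upwards [hD.1, h2] with σ h1 h2
  rw [comp_apply, comp_apply, hflow_eq _ h2 t, hflow_eq _ h1 t]
  exact D₀.flow_chainShift_of_carrier_eq_bmGood hD₀car hU0 hV0 (hcar h1) t x

/-- **Positive type of the current autocorrelation, BM class.** For `U`, `V` even non-negative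
polynomials of degree `≥ 2`, a shift-invariant state `μ` with the superstability estimate (2.3), and a
`μ`-preserving dynamics `D` with `D.carrier ⊆ 𝒳₀` and absolutely convergent correlation sums at every
time: `C = D.currentCorrelation μ` is measurable, `|C| ≤ C(0)`, and `∫_{(0,t]} (t-u) C(u) du ≥ 0` for
`t ≥ 0`. [folklore] -/
theorem currentCorrelation_positiveType_of_carrier_subset_bmGood {s₁ : ℕ} (hs₁ : 1 ≤ s₁)
    (hs₂ : 1 ≤ s₂) (hU : OscillatorChain.IsEvenPolyOfDegree P.U s₁)
    (hV : OscillatorChain.IsEvenPolyOfDegree P.V s₂) (hss : P.HasSuperstabilityEstimate μ)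
    (hμ : IsShiftInvariant μ) (hcar : D.carrier ⊆ P.bmGood) (hD : D.PreservesMeasure μ)
    (hAC : ∀ t : ℝ, D.HasAbsConvergentCorrelation μ t) :
    Measurable (D.currentCorrelation μ) ∧
    (∀ t : ℝ, |D.currentCorrelation μ t| ≤ D.currentCorrelation μ 0) ∧
    ∀ t : ℝ, 0 ≤ t → 0 ≤ ∫ u in Ioc 0 t, (t - u) * D.currentCorrelation μ u :=
  D.currentCorrelation_positiveType hss hs₂ hU.choose_spec.2.2
    hU.contDiff_two.continuous.measurable hV hD hμ
    (fun t x => D.flow_comp_chainShift_ae_of_carrier_subset_bmGood hs₁ hs₂ hU hV hcar hD hμ t x) hAC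

end InfiniteChainDynamics

end Literature.MathematicalPhysics.KineticTheory.HeatConduction

end
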